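import Summits.QuantumFields.YangMills.Theorems.BalabanLadderNTMarkovMirrorChiralFloor
import HarnessLib

/-!
# Crux `NT` (stmt-QuantumFields-19353) / `UVSeamRec.stub_floorsEngine` (stmt-QuantumFields-20043):
# the boundary response of the chirality defect is a discrete time-derivative (one-point, by parts)

Eighth file of the Markov–mirror series (fleet lead prover of crux `UVSeamRec`, unit `ym-spine-20043-p1`, g6).
The chiral composition (`…MarkovMirrorChiralFloor`, `…ChiralPackage`) consumes, besides RBL and SF, the ONE-POINT
hypothesis (RBLΔ) `|kerE_Q^ζ(Wᴿ) − kerE_Q^ζ(Ṽ) − p'| ≤ √ε/2` on the boundary response of the chirality defect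
`Wᴿ − Ṽ = ∑_x v(s·x) ∑_{q electric} (plane_q(x − e₀) − plane_q(x))`.  Here that response is computed: by linearity
of the cube kernel and a summation by parts INSIDE the cube (the lattice support of `v(s·)` sits at depth `≥ 2`),
`kerE_Q^ζ(Wᴿ) − kerE_Q^ζ(Ṽ) = ∑_x [v(s·(x + e₀)) − v(s·x)] · ∑_{q electric} kerE_Q^ζ(plane_q x)`,
so that for `p' := ∑_x [v(s·(x + e₀)) − v(s·x)] · ∑_{q electric} p_q` and ANY per-site one-point law
`|kerE_Q^ζ(plane_q x) − p_q| ≤ h` at the (shifted) support sites: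
`|kerE_Q^ζ(Wᴿ) − kerE_Q^ζ(Ṽ) − p'| ≤ N · K · 6h` (`defect_response_le`), `N` the number of support sites, `K` a
bound on the increments `|v(s·(x + e₀)) − v(s·x)|` (`≤ Lip(v)·s`).  With the femto boundary law `FBL6`
(`h = C₁ (s/κ)⁴` at depth `κ/s`) and `N ≍ s⁻⁴`, this is `O(s) → 0`: (RBLΔ) follows from `FBL6` on the cube family,
i.e. from the SAME one-point law whose refined form is RBL — no two-point input anywhere on the line.

* §1 kernel linearity: `kerE_finset_sum_mul`, `kerE_sub'`, `dens_eq_sum_subtype_plane`;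
* §2 `defect_response_eq` (summation by parts), `defect_response_le`.
-/

set_option autoImplicit false

noncomputable section

open scoped SchwartzMap
open MeasureTheory Filter Topology
open Literature.MathematicalPhysics.QuantumFieldTheory Literature.MathematicalPhysics.QuantumLattice
open Literature.Probability.LatticeModels
open Summit.QuantumFields.YangMills.Cruxes.OSLegsFromFemtoAndGap.DlrCollarTransfer
open Summit.QuantumFields.YangMills.Cruxes.OSLegsFromFemtoAndGap.DlrCollarTransfer.StubLower (mem_cubeSites_iff)
open Summit.QuantumFields.YangMills.Theorems.OSLegsFromFemtoAndGap.StubLower (integrable_of_continuous_compact)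

namespace Summit.QuantumFields.YangMills.Cruxes.NT.MarkovMirror

section Kernel

variable (G : Type) [Group G] [TopologicalSpace G] [IsTopologicalGroup G] [CompactSpace G]
  [MeasurableSpace G] [BorelSpace G] (r : LatticeRep G)

/-- Linearity of the cube kernel over finite weighted sums of continuous observables. [folklore] -/
theorem kerE_finset_sum_mul (β : ℝ) (c : Fin 4 → ℤ) (b : ℕ) (ζ : LGConfig 4 G) {ι : Type*} (S : Finset ι)
    (α : ι → ℝ) (F : ι → LGConfig 4 G → ℝ) (hF : ∀ i ∈ S, Continuous (F i)) :
    kerE G r β c b ζ (fun V => ∑ i ∈ S, α i * F i V) = ∑ i ∈ S, α i * kerE G r β c b ζ (F i) := by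
  haveI := r.secondCountableTopology
  haveI := isProbabilityMeasure_ymSpecification r.ρ r.continuous β (cubeEdges c b) ζ
  unfold kerE
  rw [integral_finsetSum S (fun i hi => (integrable_of_continuous_compact (hF i hi)).const_mul (α i))]
  exact Finset.sum_congr rfl fun i _ => integral_const_mul _ _

/-- Linearity of the cube kernel: differences of continuous observables. [folklore] -/
theorem kerE_sub' (β : ℝ) (c : Fin 4 → ℤ) (b : ℕ) (ζ : LGConfig 4 G) {F H : LGConfig 4 G → ℝ}
    (hF : Continuous F) (hH : Continuous H) :
    kerE G r β c b ζ (fun V => F V - H V) = kerE G r β c b ζ F - kerE G r β c b ζ H := by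
  haveI := r.secondCountableTopology
  haveI := isProbabilityMeasure_ymSpecification r.ρ r.continuous β (cubeEdges c b) ζ
  unfold kerE
  exact integral_sub (integrable_of_continuous_compact hF) (integrable_of_continuous_compact hH)

omit [MeasurableSpace G] [BorelSpace G] in
/-- The corner density as the sum of the six plane fields, indexed by the subtype `{q : q.1 < q.2}`. [folklore] -/
theorem dens_eq_sum_subtype_plane [MeasurableSpace G] [BorelSpace G] (x : Fin 4 → ℤ) (V : LGConfig 4 G) :
    dens G r x V = ∑ q : {q : Fin 4 × Fin 4 // q.1 < q.2}, plane G r q.1 x V := by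
  unfold dens plane
  exact actionDensity_eq_sum_subtype r.ρ (configShift (-x) V)

end Kernel

/-! ## §2 The defect response by summation by parts -/

section Defect

variable (G : Type) [Group G] [TopologicalSpace G] [IsTopologicalGroup G] [CompactSpace G]
  [MeasurableSpace G] [BorelSpace G] (r : LatticeRep G)

/-- **The boundary response of the chirality defect, by parts.**  For a cube `Q = (c, b)`, a spacing `s` and a
test function whose lattice support sits in `Q` at depth `≥ 2`, and every exterior `ζ`:
`kerE_Q^ζ(Wᴿ) − kerE_Q^ζ(Ṽ) = ∑_{x∈Q} [v(s·(x+e₀)) − v(s·x)] · ∑_q [q electric] kerE_Q^ζ(plane_q x)`.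
(Kernel linearity; for each electric orientation the shifted sum `∑_x v(s·x) k(x − e₀)` is re-indexed inside the
cube by `x ↦ x − e₀`, legitimate because the support sits at depth `≥ 2`.) [folklore] -/
theorem defect_response_eq (β : ℝ) (c : Fin 4 → ℤ) (b : ℕ) (s : ℝ) (v : 𝓢(EuclideanSpace ℝ (Fin 4), ℝ))
    (hsupp : ∀ x : Fin 4 → ℤ, v (s • siteToE x) ≠ 0 → x ∈ cubeSites c b ∧ 2 ≤ depth c b x)
    (ζ : LGConfig 4 G) :
    kerE G r β c b ζ (fun V => ∑ x ∈ cubeSites c b, v (s • siteToE x) *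
        ∑ q : {q : Fin 4 × Fin 4 // q.1 < q.2}, plane G r q.1 (if q.1.1 = 0 then x - Pi.single 0 1 else x) V) -
      kerE G r β c b ζ (fun V => ∑ y ∈ cubeSites c b, v (s • siteToE y) * dens G r y V) =
      ∑ x ∈ cubeSites c b, (v (s • siteToE (x + Pi.single 0 1)) - v (s • siteToE x)) *
        ∑ q : {q : Fin 4 × Fin 4 // q.1 < q.2}, (if q.1.1 = 0 then kerE G r β c b ζ (plane G r q.1 x) else 0) := by
  classical
  -- kernel linearity on both observables
  have hcR : ∀ x ∈ cubeSites c b, Continuous fun V : LGConfig 4 G =>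
      ∑ q : {q : Fin 4 × Fin 4 // q.1 < q.2}, plane G r q.1 (if q.1.1 = 0 then x - Pi.single 0 1 else x) V :=
    fun x _ => continuous_finsetSum _ fun q _ => continuous_plane r _ _
  have hcD : ∀ y ∈ cubeSites c b, Continuous (dens G r y) := fun y _ => continuous_dens r y
  rw [kerE_finset_sum_mul G r β c b ζ _ _ _ hcR, kerE_finset_sum_mul G r β c b ζ _ _ _ hcD]
  have hinR : ∀ x : Fin 4 → ℤ, kerE G r β c b ζ (fun V =>
      ∑ q : {q : Fin 4 × Fin 4 // q.1 < q.2}, plane G r q.1 (if q.1.1 = 0 then x - Pi.single 0 1 else x) V) =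
      ∑ q : {q : Fin 4 × Fin 4 // q.1 < q.2}, kerE G r β c b ζ (plane G r q.1 (if q.1.1 = 0 then x - Pi.single 0 1 else x)) := by
    intro x
    have h := kerE_finset_sum_mul G r β c b ζ Finset.univ (fun _ => (1 : ℝ))
      (fun q : {q : Fin 4 × Fin 4 // q.1 < q.2} => plane G r q.1 (if q.1.1 = 0 then x - Pi.single 0 1 else x))
      fun q _ => continuous_plane r _ _
    simp only [one_mul] at h
    exact h
  have hinD : ∀ y : Fin 4 → ℤ, kerE G r β c b ζ (dens G r y) =
      ∑ q : {q : Fin 4 × Fin 4 // q.1 < q.2}, kerE G r β c b ζ (plane G r q.1 y) := by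
    intro y
    have h := kerE_finset_sum_mul G r β c b ζ Finset.univ (fun _ => (1 : ℝ))
      (fun q : {q : Fin 4 × Fin 4 // q.1 < q.2} => plane G r q.1 y) fun q _ => continuous_plane r _ _
    simp only [one_mul] at h
    rw [← h]
    congr 1
    funext V
    exact dens_eq_sum_subtype_plane G r y V
  simp only [hinR, hinD]
  -- split the orientation sum into its electric part `Φ` (shifted) and magnetic part `Ψ` (unshifted)
  let Φ : (Fin 4 → ℤ) → ℝ := fun x =>
    ∑ q : {q : Fin 4 × Fin 4 // q.1 < q.2}, (if q.1.1 = 0 then kerE G r β c b ζ (plane G r q.1 x) else 0)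
  let Ψ : (Fin 4 → ℤ) → ℝ := fun x =>
    ∑ q : {q : Fin 4 × Fin 4 // q.1 < q.2}, (if q.1.1 = 0 then 0 else kerE G r β c b ζ (plane G r q.1 x))
  have eA : ∀ x : Fin 4 → ℤ, ∑ q : {q : Fin 4 × Fin 4 // q.1 < q.2},
      kerE G r β c b ζ (plane G r q.1 (if q.1.1 = 0 then x - Pi.single 0 1 else x)) =
      Φ (x - Pi.single 0 1) + Ψ x := by
    intro x
    simp only [Φ, Ψ, ← Finset.sum_add_distrib]
    refine Finset.sum_congr rfl fun q _ => ?_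
    split_ifs <;> simp
  have eB : ∀ x : Fin 4 → ℤ, ∑ q : {q : Fin 4 × Fin 4 // q.1 < q.2}, kerE G r β c b ζ (plane G r q.1 x) =
      Φ x + Ψ x := by
    intro x
    simp only [Φ, Ψ, ← Finset.sum_add_distrib]
    refine Finset.sum_congr rfl fun q _ => ?_
    split_ifs <;> simp
  simp only [eA, eB]
  change _ = ∑ x ∈ cubeSites c b, (v (s • siteToE (x + Pi.single 0 1)) - v (s • siteToE x)) * Φ x
  -- summation by parts: `∑_x v(s·x) Φ(x − e₀) = ∑_x v(s·(x+e₀)) Φ(x)`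
  have hparts : ∑ x ∈ cubeSites c b, v (s • siteToE x) * Φ (x - Pi.single 0 1) =
      ∑ x ∈ cubeSites c b, v (s • siteToE (x + Pi.single 0 1)) * Φ x := by
    refine Finset.sum_bij_ne_zero (fun x _ _ => x - Pi.single 0 1) (fun x hx hne => ?_)
      (fun x₁ _ _ x₂ _ _ h => sub_left_injective h) (fun y _ hne => ?_) (fun x _ _ => by rw [sub_add_cancel])
    · -- `x − e₀ ∈ Q` since `v(s·x) ≠ 0` forces depth `≥ 2`
      have hv : v (s • siteToE x) ≠ 0 := fun h => hne (by rw [h, zero_mul])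
      have hd := window_of_two_le_depth (hsupp x hv).2
      rw [mem_cubeSites_iff]
      intro j
      have := hd j
      have hx' := (mem_cubeSites_iff _ _ _).1 hx j
      by_cases hj : j = 0
      · subst hj; simp only [Pi.sub_apply, Pi.single_eq_same]; constructor <;> linarith
      · simp only [Pi.sub_apply, Pi.single_eq_of_ne hj, sub_zero]; exact hx'
    · have hv : v (s • siteToE (y + Pi.single 0 1)) ≠ 0 := fun h => hne (by rw [h, zero_mul])
      exact ⟨y + Pi.single 0 1, (hsupp _ hv).1, by rw [add_sub_cancel_right]; exact hne, add_sub_cancel_right _ _⟩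
  have e3 : ∀ x ∈ cubeSites c b, v (s • siteToE x) * (Φ (x - Pi.single 0 1) + Ψ x) -
      v (s • siteToE x) * (Φ x + Ψ x) = v (s • siteToE x) * Φ (x - Pi.single 0 1) - v (s • siteToE x) * Φ x := by
    intro x _; ring
  rw [← Finset.sum_sub_distrib, Finset.sum_congr rfl e3, Finset.sum_sub_distrib, hparts, ← Finset.sum_sub_distrib]
  exact Finset.sum_congr rfl fun x _ => by ring

/-- **The defect response is small under a per-site one-point law.**  With the notation of `defect_response_eq`,
reference values `p_q` and `p' := ∑_x [v(s·(x+e₀)) − v(s·x)] ∑_q [q electric] p_q`: if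
`|kerE_Q^ζ(plane_q x) − p_q| ≤ h` for every electric `q` at every site `x ∈ Q` where `v(s·x) ≠ 0` or
`v(s·(x+e₀)) ≠ 0`, the increments obey `|v(s·(x+e₀)) − v(s·x)| ≤ K`, and there are at most `N` such sites, then
`|kerE_Q^ζ(Wᴿ) − kerE_Q^ζ(Ṽ) − p'| ≤ N · (K · (6 h))`. [folklore] -/
theorem defect_response_le (β : ℝ) (c : Fin 4 → ℤ) (b : ℕ) (s : ℝ) (v : 𝓢(EuclideanSpace ℝ (Fin 4), ℝ))
    (hsupp : ∀ x : Fin 4 → ℤ, v (s • siteToE x) ≠ 0 → x ∈ cubeSites c b ∧ 2 ≤ depth c b x)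
    (ζ : LGConfig 4 G) (pq : {q : Fin 4 × Fin 4 // q.1 < q.2} → ℝ) {h K : ℝ} (hh : 0 ≤ h) (hK : 0 ≤ K)
    (hBL : ∀ q : {q : Fin 4 × Fin 4 // q.1 < q.2}, q.1.1 = 0 → ∀ x ∈ cubeSites c b,
      (v (s • siteToE x) ≠ 0 ∨ v (s • siteToE (x + Pi.single 0 1)) ≠ 0) →
        |kerE G r β c b ζ (plane G r q.1 x) - pq q| ≤ h)
    (hLip : ∀ x : Fin 4 → ℤ, |v (s • siteToE (x + Pi.single 0 1)) - v (s • siteToE x)| ≤ K)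
    (N : ℕ) (hN : ((cubeSites c b).filter fun x =>
      v (s • siteToE x) ≠ 0 ∨ v (s • siteToE (x + Pi.single 0 1)) ≠ 0).card ≤ N) :
    |kerE G r β c b ζ (fun V => ∑ x ∈ cubeSites c b, v (s • siteToE x) *
          ∑ q : {q : Fin 4 × Fin 4 // q.1 < q.2}, plane G r q.1 (if q.1.1 = 0 then x - Pi.single 0 1 else x) V) -
        kerE G r β c b ζ (fun V => ∑ y ∈ cubeSites c b, v (s • siteToE y) * dens G r y V) -
        ∑ x ∈ cubeSites c b, (v (s • siteToE (x + Pi.single 0 1)) - v (s • siteToE x)) *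
          ∑ q : {q : Fin 4 × Fin 4 // q.1 < q.2}, (if q.1.1 = 0 then pq q else 0)| ≤ N * (K * (6 * h)) := by
  classical
  rw [defect_response_eq G r β c b s v hsupp ζ, ← Finset.sum_sub_distrib]
  set T := (cubeSites c b).filter fun x =>
    v (s • siteToE x) ≠ 0 ∨ v (s • siteToE (x + Pi.single 0 1)) ≠ 0 with hT
  -- the summand, and its vanishing off `T`
  have hterm : ∀ x ∈ cubeSites c b,
      (v (s • siteToE (x + Pi.single 0 1)) - v (s • siteToE x)) *
          ∑ q : {q : Fin 4 × Fin 4 // q.1 < q.2}, (if q.1.1 = 0 then kerE G r β c b ζ (plane G r q.1 x) else 0) -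
        (v (s • siteToE (x + Pi.single 0 1)) - v (s • siteToE x)) *
          ∑ q : {q : Fin 4 × Fin 4 // q.1 < q.2}, (if q.1.1 = 0 then pq q else 0) =
      (v (s • siteToE (x + Pi.single 0 1)) - v (s • siteToE x)) *
        ∑ q : {q : Fin 4 × Fin 4 // q.1 < q.2}, (if q.1.1 = 0 then kerE G r β c b ζ (plane G r q.1 x) - pq q else 0) := by
    intro x _
    rw [← mul_sub, ← Finset.sum_sub_distrib]
    congr 1
    refine Finset.sum_congr rfl fun q _ => ?_
    split_ifs <;> ring
  rw [Finset.sum_congr rfl hterm]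
  rw [← Finset.sum_filter_add_sum_filter_not (cubeSites c b)
    (fun x => v (s • siteToE x) ≠ 0 ∨ v (s • siteToE (x + Pi.single 0 1)) ≠ 0)]
  have hzero : ∑ x ∈ (cubeSites c b).filter
      (fun x => ¬(v (s • siteToE x) ≠ 0 ∨ v (s • siteToE (x + Pi.single 0 1)) ≠ 0)),
      (v (s • siteToE (x + Pi.single 0 1)) - v (s • siteToE x)) *
        ∑ q : {q : Fin 4 × Fin 4 // q.1 < q.2},
          (if q.1.1 = 0 then kerE G r β c b ζ (plane G r q.1 x) - pq q else 0) = 0 := by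
    refine Finset.sum_eq_zero fun x hx => ?_
    obtain ⟨-, hx⟩ := Finset.mem_filter.1 hx
    push Not at hx
    rw [hx.1, hx.2, sub_zero, zero_mul]
  rw [hzero, add_zero, ← hT]
  -- termwise bound on `T`
  have hbound : ∀ x ∈ T, |(v (s • siteToE (x + Pi.single 0 1)) - v (s • siteToE x)) *
      ∑ q : {q : Fin 4 × Fin 4 // q.1 < q.2},
        (if q.1.1 = 0 then kerE G r β c b ζ (plane G r q.1 x) - pq q else 0)| ≤ K * (6 * h) := by
    intro x hx
    obtain ⟨hxc, hxv⟩ := Finset.mem_filter.1 hx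
    rw [abs_mul]
    refine mul_le_mul (hLip x) ?_ (abs_nonneg _) hK
    calc |∑ q : {q : Fin 4 × Fin 4 // q.1 < q.2},
          (if q.1.1 = 0 then kerE G r β c b ζ (plane G r q.1 x) - pq q else 0)|
        ≤ ∑ q : {q : Fin 4 × Fin 4 // q.1 < q.2},
          |(if q.1.1 = 0 then kerE G r β c b ζ (plane G r q.1 x) - pq q else 0)| := Finset.abs_sum_le_sum_abs _ _
      _ ≤ ∑ _q : {q : Fin 4 × Fin 4 // q.1 < q.2}, h := by
          refine Finset.sum_le_sum fun q _ => ?_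
          split_ifs with hq
          · exact hBL q hq x hxc hxv
          · rw [abs_zero]; exact hh
      _ = 6 * h := by
          rw [Finset.sum_const, Finset.card_univ, nsmul_eq_mul]
          have : Fintype.card {q : Fin 4 × Fin 4 // q.1 < q.2} = 6 := by decide
          rw [this]; push_cast; ring
  calc |∑ x ∈ T, (v (s • siteToE (x + Pi.single 0 1)) - v (s • siteToE x)) *
        ∑ q : {q : Fin 4 × Fin 4 // q.1 < q.2},
          (if q.1.1 = 0 then kerE G r β c b ζ (plane G r q.1 x) - pq q else 0)|
      ≤ ∑ x ∈ T, |(v (s • siteToE (x + Pi.single 0 1)) - v (s • siteToE x)) *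
        ∑ q : {q : Fin 4 × Fin 4 // q.1 < q.2},
          (if q.1.1 = 0 then kerE G r β c b ζ (plane G r q.1 x) - pq q else 0)| := Finset.abs_sum_le_sum_abs _ _
    _ ≤ ∑ _x ∈ T, K * (6 * h) := Finset.sum_le_sum hbound
    _ = T.card * (K * (6 * h)) := by rw [Finset.sum_const, nsmul_eq_mul]
    _ ≤ N * (K * (6 * h)) := by
        have : (T.card : ℝ) ≤ N := by exact_mod_cast hN
        exact mul_le_mul_of_nonneg_right this (by positivity)

end Defect

end Summit.QuantumFields.YangMills.Cruxes.NT.MarkovMirror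

end
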